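import Summits.AtomisticToContinuum.FouriersLaw.Theorems.EmbeddedDrudeMourreMourreDissolutionFrameworkReflection
import Literature.MathematicalPhysics.KineticTheory.ZeroWavenumberSpace
import Literature.MathematicalPhysics.KineticTheory.FluctuationSpaceStone
import Literature.MathematicalPhysics.KineticTheory.FluctuationFoelnerPositivity
import Literature.MathematicalPhysics.KineticTheory.FluctuationStrongContinuityGenerators

/-!
# `EmbeddedDrudeMourre.MourreDissolution`, line `separable-vertex-faddeev-pair-sector` —
# helpers for stub `stub_symmetricFramework`, part 2/3: the symmetric zero-wavenumber datum

Item `stmt-AtomisticToContinuum-12594` (crux `MourreDissolution` of route `EmbeddedDrudeMourre`,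
sub-problem `FouriersLaw`), registered stub `stub_symmetricFramework` (S1) of the line skeleton
`Cruxes/MourreDissolution/Lines/separable_vertex_faddeev_pair_sector.lean`; sequel of part 1/3
(`…FrameworkReflection`: the reflection `ι σ = σ(−·)`, the canonical symmetric dynamics, the
`R`-invariance of DLR states).

This part CONSTRUCTS Doyon's zero-wavenumber datum from scalar clustering inputs
(`exists_zeroWavenumberData_of_clustering`). Given a dynamics `D` of a chain `P` with even
interaction `V`, with `φ_0 = id`, exact group law and exact `τ`/`R`/`ι` covariance; a `D`-invariant,
shift-invariant, `R`-invariant probability measure `μ` in which `j₀, h₀ ∈ L²(μ)`; and the two SCALAR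
analytic inputs — summability in `x` of `Cov_μ(a, (b ∘ τ_x) ∘ φ_u)` for `a, b ∈ {j₀, h₀}` and every
`u`, and continuity at `t = 0` of `t ↦ Σ_x Cov_μ(a, (a ∘ τ_x) ∘ φ_t)` for `a ∈ {j₀, h₀}` — we build
a `ZeroWavenumberData P D` with state `μ` and local observables
`𝒱 = span{(a ∘ τ_x) ∘ φ_s : a ∈ {j₀, h₀}}`, and derive all its fields: summable clustering on
`𝒱 × 𝒱` by bilinearity and stationarity (`cov_gen_gen_shift`), `form_self_nonneg` by the tree's
Følner lemma (`integral_count_covariance_comp_shift_nonneg`), `R`- and `ι`-stability of `𝒱` from the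
parities `j₀ ∘ R = -j₀`, `h₀ ∘ R = h₀`, `j₀ ∘ ι = -j₋₁`, `h₀ ∘ ι = h₀`, and strong continuity of the
Koopman group by the tree's `ZeroWavenumberData.isStronglyContinuous_of_generators`.
-/

noncomputable section

namespace Summit.AtomisticToContinuum.FouriersLaw.Theorems.MourreDissolution

open Filter Topology MeasureTheory ProbabilityTheory Set Function
open Literature.MathematicalPhysics.KineticTheory
open Literature.MathematicalPhysics.KineticTheory.HeatConduction

section Assembly

variable {P : OscillatorChain} (D : InfiniteChainDynamics P)

/-- `j₀ ∘ R = -j₀` as functions. [folklore] -/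
theorem bondCurrentZ_zero_comp_chainReversal :
    ((fun σ => P.bondCurrentZ σ 0) ∘ chainReversal) = -fun σ => P.bondCurrentZ σ 0 := by
  funext σ
  simp only [comp_apply, P.bondCurrentZ_chainReversal, Pi.neg_apply]

/-- `h₀ ∘ R = h₀` as functions. [folklore] -/
theorem energyDensityZ_zero_comp_chainReversal :
    ((fun σ => P.energyDensityZ σ 0) ∘ chainReversal) = fun σ => P.energyDensityZ σ 0 := by
  funext σ
  simp only [comp_apply, P.energyDensityZ_chainReversal]

/-- `j₀ ∘ ι = -(j₀ ∘ τ_{-1})` for an even interaction (`V'` odd). [folklore] -/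
theorem bondCurrentZ_zero_comp_reflect (hV : ∀ r, P.V (-r) = P.V r) :
    ((fun σ => P.bondCurrentZ σ 0) ∘ fun (σ : ℤ → ℝ × ℝ) (y : ℤ) => σ (-y)) =
      -((fun σ => P.bondCurrentZ σ 0) ∘ chainShift (-1)) := by
  funext σ
  simp only [comp_apply, Pi.neg_apply, OscillatorChain.bondCurrentZ, chainShift_apply, neg_zero,
    zero_add, add_neg_cancel]
  have h : deriv P.V ((σ (-1)).1 - (σ 0).1) = -deriv P.V ((σ 0).1 - (σ (-1)).1) := by
    rw [← neg_sub, P.deriv_V_neg hV]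
  rw [h]
  ring

/-- `h₀ ∘ ι = h₀` for an even interaction. [folklore] -/
theorem energyDensityZ_zero_comp_reflect (hV : ∀ r, P.V (-r) = P.V r) :
    ((fun σ => P.energyDensityZ σ 0) ∘ fun (σ : ℤ → ℝ × ℝ) (y : ℤ) => σ (-y)) =
      fun σ => P.energyDensityZ σ 0 := by
  funext σ
  simp only [comp_apply, OscillatorChain.energyDensityZ, neg_zero, zero_add, zero_sub, neg_neg]
  have h1 : P.V ((σ (-1)).1 - (σ 0).1) = P.V ((σ 0).1 - (σ (-1)).1) := by rw [← neg_sub, hV]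
  have h2 : P.V ((σ 0).1 - (σ 1).1) = P.V ((σ 1).1 - (σ 0).1) := by rw [← neg_sub, hV]
  rw [h1, h2]
  ring

/-- Precomposition closure of a span: if `b ∘ g ∈ span S` for every `b ∈ S` then `v ∘ g ∈ span S`
for every `v ∈ span S` (precomposition is linear, `LinearMap.funLeft`). [folklore] -/
theorem comp_mem_span_of_forall {S : Set (ChainConfig → ℝ)} (g : ChainConfig → ChainConfig)
    (hS : ∀ b ∈ S, b ∘ g ∈ Submodule.span ℝ S) {v : ChainConfig → ℝ}
    (hv : v ∈ Submodule.span ℝ S) : v ∘ g ∈ Submodule.span ℝ S := by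
  have hle : Submodule.span ℝ S ≤ (Submodule.span ℝ S).comap (LinearMap.funLeft ℝ ℝ g) :=
    Submodule.span_le.2 fun b hb => hS b hb
  exact hle hv

variable {D}

/-- With the exact commutation `φ_s ∘ τ_y = τ_y ∘ φ_s`: `((a ∘ τ_x) ∘ φ_s) ∘ τ_y = (a ∘ τ_{x+y}) ∘ φ_s`.
[folklore] -/
theorem gen_comp_chainShift (hsh : ∀ (t : ℝ) (x : ℤ), D.flow t ∘ chainShift x = chainShift x ∘ D.flow t)
    (a : ChainConfig → ℝ) (x : ℤ) (s : ℝ) (y : ℤ) :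
    ((a ∘ chainShift x) ∘ D.flow s) ∘ chainShift y = (a ∘ chainShift (x + y)) ∘ D.flow s := by
  funext σ
  have h := congrFun (hsh s y) σ
  simp only [comp_apply] at h ⊢
  rw [h, ShiftAction.apply_add]

/-- With the exact group law: `((a ∘ τ_x) ∘ φ_s) ∘ φ_t = (a ∘ τ_x) ∘ φ_{s+t}`. [folklore] -/
theorem gen_comp_flow (hgrp : ∀ t s : ℝ, D.flow (t + s) = D.flow t ∘ D.flow s)
    (a : ChainConfig → ℝ) (x : ℤ) (s t : ℝ) :
    ((a ∘ chainShift x) ∘ D.flow s) ∘ D.flow t = (a ∘ chainShift x) ∘ D.flow (s + t) := by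
  rw [hgrp s t]
  rfl

/-- **Stationarity reduction of generator covariances**: for a `φ`- and `τ`-invariant `μ`,
`Cov((a∘τ_{y₁})∘φ_{s₁}, ((b∘τ_{y₂})∘φ_{s₂})∘τ_x) = Cov(a, (b∘τ_{x+(y₂-y₁)})∘φ_{s₂-s₁})`. [folklore] -/
theorem cov_gen_gen_shift (hgrp : ∀ t s : ℝ, D.flow (t + s) = D.flow t ∘ D.flow s)
    (hsh : ∀ (t : ℝ) (x : ℤ), D.flow t ∘ chainShift x = chainShift x ∘ D.flow t)
    {μ : Measure ChainConfig} (hflow : ∀ t, MeasurePreserving (D.flow t) μ μ)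
    (hT : ∀ x, MeasurePreserving (chainShift x) μ μ)
    {a b : ChainConfig → ℝ} (ha : AEStronglyMeasurable a μ) (hb : AEStronglyMeasurable b μ)
    (y₁ y₂ x : ℤ) (s₁ s₂ : ℝ) :
    cov[(a ∘ chainShift y₁) ∘ D.flow s₁, (((b ∘ chainShift y₂) ∘ D.flow s₂) ∘ chainShift x); μ] =
      cov[a, (b ∘ chainShift (x + (y₂ - y₁))) ∘ D.flow (s₂ - s₁); μ] := by
  -- AEStronglyMeasurable is stable under the measure-preserving maps
  have hae : ∀ {f : ChainConfig → ℝ}, AEStronglyMeasurable f μ → ∀ {g : ChainConfig → ChainConfig},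
      MeasurePreserving g μ μ → AEStronglyMeasurable (f ∘ g) μ := by
    intro f hf g hg
    have h : AEStronglyMeasurable f (μ.map g) := by rwa [hg.map_eq]
    exact h.comp_measurable hg.measurable
  -- step 1: remove `φ_{s₁}`
  have e1 : ((b ∘ chainShift y₂) ∘ D.flow s₂) ∘ chainShift x =
      ((b ∘ chainShift (y₂ + x)) ∘ D.flow (s₂ - s₁)) ∘ D.flow s₁ := by
    rw [gen_comp_chainShift hsh, gen_comp_flow hgrp, sub_add_cancel]
  rw [e1, covariance_comp_measurePreserving (hflow s₁) (hae ha (hT y₁))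
    (hae (hae hb (hT _)) (hflow _))]
  -- step 2: remove `τ_{y₁}`
  have e3 : (b ∘ chainShift (y₂ + x)) ∘ D.flow (s₂ - s₁) =
      ((b ∘ chainShift (x + (y₂ - y₁))) ∘ D.flow (s₂ - s₁)) ∘ chainShift y₁ := by
    rw [gen_comp_chainShift hsh]
    have : x + (y₂ - y₁) + y₁ = y₂ + x := by ring
    rw [this]
  rw [e3, covariance_comp_measurePreserving (hT y₁) ha (hae (hae hb (hT _)) (hflow _))]

end Assembly

/-! ## The assembled datum -/

/-- **The symmetric zero-wavenumber datum from scalar clustering inputs** (the registered helper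
stub of this file, stated with all binders explicit and fully qualified names). See the module
docstring. Inputs: a chain `P` with even `V`; a dynamics `D` with `φ_0 = id`, exact group law and
exact `τ`/`R`/`ι` covariance; a `D`-invariant, shift-invariant, `R`-invariant probability measure
`μ` with `j₀, h₀ ∈ L²(μ)` (`ι`-invariance of `μ` is not needed for the construction; it enters only
the final statement, part 3/3); summable `x ↦ Cov(a, (b∘τ_x)∘φ_u)` (`a, b ∈ {j₀, h₀}`, all `u`) and
continuity at `0` of `t ↦ Σ_x Cov(a, (a∘τ_x)∘φ_t)` (`a ∈ {j₀, h₀}`). Output: a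
`ZeroWavenumberData P D` with state `μ`, momentum-reversal symmetric, reflection symmetric (state,
observables, flow) and with strongly continuous Koopman group.
[cite: Doyon2022, §4.1 Def. 4.3–4.4 and §4.3 Thm 4.11] -/
theorem exists_zeroWavenumberData_of_clustering : ∀ (P : Literature.MathematicalPhysics.KineticTheory.HeatConduction.OscillatorChain) (D : Literature.MathematicalPhysics.KineticTheory.HeatConduction.InfiniteChainDynamics P), (∀ r : ℝ, P.V (-r) = P.V r) → D.flow 0 = id → (∀ t s : ℝ, D.flow (t + s) = D.flow t ∘ D.flow s) → (∀ (t : ℝ) (x : ℤ), D.flow t ∘ Literature.MathematicalPhysics.KineticTheory.HeatConduction.chainShift x = Literature.MathematicalPhysics.KineticTheory.HeatConduction.chainShift x ∘ D.flow t) → (∀ t : ℝ, Literature.MathematicalPhysics.KineticTheory.HeatConduction.chainReversal ∘ D.flow t = D.flow (-t) ∘ Literature.MathematicalPhysics.KineticTheory.HeatConduction.chainReversal) → (∀ t : ℝ, (fun (σ : ℤ → ℝ × ℝ) (y : ℤ) => σ (-y)) ∘ D.flow t = D.flow t ∘ fun (σ : ℤ → ℝ × ℝ) (y : ℤ) =>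 σ (-y)) → ∀ (μ : MeasureTheory.Measure (ℤ → ℝ × ℝ)) [MeasureTheory.IsProbabilityMeasure μ], D.PreservesMeasure μ → (∀ x : ℤ, MeasureTheory.MeasurePreserving (Literature.MathematicalPhysics.KineticTheory.HeatConduction.chainShift x) μ μ) → MeasureTheory.MeasurePreserving Literature.MathematicalPhysics.KineticTheory.HeatConduction.chainReversal μ μ → MeasureTheory.MemLp (fun σ => P.bondCurrentZ σ 0) 2 μ → MeasureTheory.MemLp (fun σ => P.energyDensityZ σ 0) 2 μ → (∀ a ∈ ({fun σ => P.bondCurrentZ σ 0, fun σ => P.energyDensityZ σ 0} : Set ((ℤ → ℝ × ℝ) → ℝ)), ∀ b ∈ ({fun σ => P.bondCurrentZ σ 0, fun σ => P.energyDensityZ σ 0} : Set ((ℤ → ℝ × ℝ) → ℝ)), ∀ u : ℝ, Summable fun x : ℤ => ProbabilityTheory.covariance a ((b ∘ Literature.MathematicalPhysics.KineticTheory.HeatConduction.chainShift x) ∘ D.flow u) μ) → (∀ a ∈ ({fun σ => P.bondCurrentZ σ 0, fun σ => P.energyDensityZ σ 0} : Set ((ℤ → ℝ × ℝ) → ℝ)),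 ContinuousAt (fun t : ℝ => ∑' x : ℤ, ProbabilityTheory.covariance a ((a ∘ Literature.MathematicalPhysics.KineticTheory.HeatConduction.chainShift x) ∘ D.flow t) μ) 0) → ∃ Z : Literature.MathematicalPhysics.KineticTheory.HeatConduction.ZeroWavenumberData P D, Z.μ = μ ∧ Z.HasMomentumReversal ∧ (∀ a : (ℤ → ℝ × ℝ) → ℝ, a ∈ Z.localObs → (a ∘ fun (σ : ℤ → ℝ × ℝ) (x : ℤ) => σ (-x)) ∈ Z.localObs) ∧ (∀ t : ℝ, (fun (σ : ℤ → ℝ × ℝ) (x : ℤ) => σ (-x)) ∘ D.flow t =ᵐ[Z.μ] D.flow t ∘ fun (σ : ℤ → ℝ × ℝ) (x : ℤ) => σ (-x)) ∧ (∀ ψ : Literature.MathematicalPhysics.KineticTheory.HeatConduction.ZeroWavenumberSpace Z, Continuous fun t : ℝ => Z.koopman t ψ) := by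
  intro P D hV h0 hgrp hsh hrev hrefl μ _ hpres hT hRμ hjm hhm hsum hcont
  classical
  -- the generators and their span
  set G : Set (ChainConfig → ℝ) :=
    ({fun σ => P.bondCurrentZ σ 0, fun σ => P.energyDensityZ σ 0} : Set (ChainConfig → ℝ)) with hG
  set S : Set (ChainConfig → ℝ) :=
    {b | ∃ a ∈ G, ∃ (x : ℤ) (s : ℝ), b = (a ∘ chainShift x) ∘ D.flow s} with hS
  set V : Submodule ℝ (ChainConfig → ℝ) := Submodule.span ℝ S with hVdef
  have hjG : (fun σ => P.bondCurrentZ σ 0) ∈ G := by rw [hG]; exact Set.mem_insert _ _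
  have hhG : (fun σ => P.energyDensityZ σ 0) ∈ G := by
    rw [hG]; exact Set.mem_insert_of_mem _ (Set.mem_singleton _)
  have hflow : ∀ t, MeasurePreserving (D.flow t) μ μ := hpres.2
  have hGmem : ∀ a ∈ G, MemLp a 2 μ := by
    intro a ha
    rcases ha with rfl | rfl
    · exact hjm
    · exact hhm
  have hgenS : ∀ a ∈ G, ∀ (x : ℤ) (s : ℝ), (a ∘ chainShift x) ∘ D.flow s ∈ S :=
    fun a ha x s => ⟨a, ha, x, s, rfl⟩
  have hGS : ∀ a ∈ G, a ∈ S := by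
    intro a ha
    refine ⟨a, ha, 0, 0, ?_⟩
    funext σ
    simp only [comp_apply, h0, id_eq, ShiftAction.apply_zero]
  -- square integrability on `S` and on the span
  have hSmem : ∀ b ∈ S, MemLp b 2 μ := by
    rintro b ⟨a, ha, x, s, rfl⟩
    exact ((hGmem a ha).comp_measurePreserving (hT x)).comp_measurePreserving (hflow s)
  have hVmem : ∀ ⦃v : ChainConfig → ℝ⦄, v ∈ V → MemLp v 2 μ := by
    intro v hv
    induction hv using Submodule.span_induction with
    | mem b hb => exact hSmem b hb
    | zero => exact MemLp.zero
    | add b b' _ _ hb hb' => exact hb.add hb'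
    | smul c b _ hb => exact hb.const_smul c
  -- stability of `S` (hence of `V`) under translations and the flow
  have hV_shift : ∀ (y : ℤ) ⦃v : ChainConfig → ℝ⦄, v ∈ V → v ∘ chainShift y ∈ V := by
    intro y v hv
    refine comp_mem_span_of_forall (chainShift y) (fun b hb => ?_) hv
    obtain ⟨a, ha, x, s, rfl⟩ := hb
    rw [gen_comp_chainShift hsh]
    exact Submodule.subset_span (hgenS a ha _ _)
  have hV_flow : ∀ (t : ℝ) ⦃v : ChainConfig → ℝ⦄, v ∈ V → v ∘ D.flow t ∈ V := by
    intro t v hv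
    refine comp_mem_span_of_forall (D.flow t) (fun b hb => ?_) hv
    obtain ⟨a, ha, x, s, rfl⟩ := hb
    rw [gen_comp_flow hgrp]
    exact Submodule.subset_span (hgenS a ha _ _)
  -- summable clustering: generators, then the span (two inductions)
  have hSS : ∀ b₁ ∈ S, ∀ b₂ ∈ S, Summable fun x : ℤ => cov[b₁, b₂ ∘ chainShift x; μ] := by
    rintro b₁ ⟨a, ha, y₁, s₁, rfl⟩ b₂ ⟨b, hb, y₂, s₂, rfl⟩
    have h := hsum a ha b hb (s₂ - s₁)
    have h' := (Equiv.summable_iff (Equiv.addRight (y₂ - y₁))).2 h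
    refine h'.congr fun x => ?_
    simp only [comp_apply, Equiv.coe_addRight]
    exact (cov_gen_gen_shift hgrp hsh hflow hT (hGmem a ha).aestronglyMeasurable
      (hGmem b hb).aestronglyMeasurable y₁ y₂ x s₁ s₂).symm
  have hVS : ∀ ⦃v : ChainConfig → ℝ⦄, v ∈ V → ∀ b ∈ S,
      Summable fun x : ℤ => cov[v, b ∘ chainShift x; μ] := by
    intro v hv
    induction hv using Submodule.span_induction with
    | mem b hb => exact fun b' hb' => hSS b hb b' hb'
    | zero => intro b hb; simp only [covariance_zero_left]; exact summable_zero
    | add v v' hv hv' ih ih' =>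
        intro b hb
        refine ((ih b hb).add (ih' b hb)).congr fun x => ?_
        exact (covariance_add_left (hVmem hv) (hVmem hv')
          ((hSmem b hb).comp_measurePreserving (hT x))).symm
    | smul c v hv ih =>
        intro b hb
        refine ((ih b hb).mul_left c).congr fun x => ?_
        exact (covariance_smul_left c).symm
  have hVV : ∀ ⦃v : ChainConfig → ℝ⦄, v ∈ V → ∀ ⦃w : ChainConfig → ℝ⦄, w ∈ V →
      Summable fun x : ℤ => cov[v, w ∘ chainShift x; μ] := by
    intro v hv w hw
    induction hw using Submodule.span_induction with
    | mem b hb => exact hVS hv b hb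
    | zero =>
        have : ∀ x : ℤ, ((0 : ChainConfig → ℝ) ∘ chainShift x) = 0 := fun x => rfl
        simp only [this, covariance_zero_right]; exact summable_zero
    | add w w' hw hw' ih ih' =>
        refine (ih.add ih').congr fun x => ?_
        have e : (w + w') ∘ chainShift x = w ∘ chainShift x + w' ∘ chainShift x := rfl
        rw [e]
        exact (covariance_add_right (hVmem hv) ((hVmem hw).comp_measurePreserving (hT x))
          ((hVmem hw').comp_measurePreserving (hT x))).symm
    | smul c w hw ih =>
        refine (ih.mul_left c).congr fun x => ?_
        have e : (c • w) ∘ chainShift x = c • (w ∘ chainShift x) := rfl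
        rw [e]
        exact (covariance_smul_right c).symm
  have hVint : ∀ ⦃v : ChainConfig → ℝ⦄, v ∈ V → ∀ ⦃w : ChainConfig → ℝ⦄, w ∈ V →
      Integrable (fun x : ℤ => cov[v, w ∘ chainShift x; μ]) (Measure.count : Measure ℤ) := by
    intro v hv w hw
    rw [integrable_count_iff]
    simpa only [Real.norm_eq_abs] using (hVV hv hw).abs
  -- the datum
  let Z : ZeroWavenumberData P D :=
    { μ := μ
      isProbabilityMeasure := inferInstance
      measurePreserving_shift := hT
      localObs := V
      memLp_of_mem := hVmem
      comp_shift_mem := hV_shift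
      integrable_cov := hVint
      form_self_nonneg := @fun a ha =>
        integral_count_covariance_comp_shift_nonneg chainShift hT (hVmem ha) (hVint ha ha)
      ae_mem_carrier := hpres.1
      measurePreserving_flow := hflow
      flow_comm_shift := fun t x => Eventually.of_forall fun σ => congrFun (hsh t x) σ
      comp_flow_mem := hV_flow
      bondCurrent_mem := Submodule.subset_span (hGS _ hjG)
      energyDensity_mem := Submodule.subset_span (hGS _ hhG) }
  -- parities of the generators under `R` and `ι`
  have hGR : ∀ a ∈ G, ∃ c : ℝ, a ∘ chainReversal = c • a := by
    intro a ha
    rcases ha with rfl | rfl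
    · exact ⟨-1, by rw [bondCurrentZ_zero_comp_chainReversal, neg_one_smul ℝ]⟩
    · exact ⟨1, by rw [energyDensityZ_zero_comp_chainReversal, one_smul]⟩
  have hGι : ∀ a ∈ G, ∃ (c : ℝ) (y : ℤ), ∃ a' ∈ G,
      (a ∘ fun (σ : ℤ → ℝ × ℝ) (z : ℤ) => σ (-z)) = c • (a' ∘ chainShift y) := by
    intro a ha
    rcases ha with rfl | rfl
    · exact ⟨-1, -1, _, hjG, by rw [bondCurrentZ_zero_comp_reflect hV, neg_one_smul ℝ]⟩
    · refine ⟨1, 0, _, hhG, ?_⟩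
      rw [energyDensityZ_zero_comp_reflect hV, one_smul]
      funext σ
      simp only [comp_apply, ShiftAction.apply_zero]
  -- `R`-stability of `V`
  have hV_R : ∀ ⦃v : ChainConfig → ℝ⦄, v ∈ V → v ∘ chainReversal ∈ V := by
    intro v hv
    refine comp_mem_span_of_forall chainReversal (fun b hb => ?_) hv
    obtain ⟨a, ha, x, s, rfl⟩ := hb
    obtain ⟨c, hc⟩ := hGR a ha
    have e : ((a ∘ chainShift x) ∘ D.flow s) ∘ chainReversal =
        c • ((a ∘ chainShift x) ∘ D.flow (-s)) := by
      have h1 : D.flow s ∘ chainReversal = chainReversal ∘ D.flow (-s) := by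
        have := hrev (-s); rw [neg_neg] at this; exact this.symm
      calc ((a ∘ chainShift x) ∘ D.flow s) ∘ chainReversal
          = (a ∘ chainShift x) ∘ (D.flow s ∘ chainReversal) := rfl
        _ = (a ∘ chainShift x) ∘ (chainReversal ∘ D.flow (-s)) := by rw [h1]
        _ = ((a ∘ chainReversal) ∘ chainShift x) ∘ D.flow (-s) := rfl
        _ = c • ((a ∘ chainShift x) ∘ D.flow (-s)) := by rw [hc]; rfl
    rw [e]
    exact V.smul_mem c (Submodule.subset_span (hgenS a ha _ _))
  -- `ι`-stability of `V`
  have hV_ι : ∀ ⦃v : ChainConfig → ℝ⦄, v ∈ V →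
      (v ∘ fun (σ : ℤ → ℝ × ℝ) (z : ℤ) => σ (-z)) ∈ V := by
    intro v hv
    refine comp_mem_span_of_forall (fun (σ : ℤ → ℝ × ℝ) (z : ℤ) => σ (-z)) (fun b hb => ?_) hv
    obtain ⟨a, ha, x, s, rfl⟩ := hb
    obtain ⟨c, y, a', ha', hc⟩ := hGι a ha
    have e : ((a ∘ chainShift x) ∘ D.flow s) ∘ (fun (σ : ℤ → ℝ × ℝ) (z : ℤ) => σ (-z)) =
        c • ((a' ∘ chainShift (y + -x)) ∘ D.flow s) := by
      have h2 : chainShift x ∘ (fun (σ : ℤ → ℝ × ℝ) (z : ℤ) => σ (-z)) =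
          (fun (σ : ℤ → ℝ × ℝ) (z : ℤ) => σ (-z)) ∘ chainShift (-x) := by
        have := reflect_comp_chainShift (-x); rw [neg_neg] at this; exact this.symm
      calc ((a ∘ chainShift x) ∘ D.flow s) ∘ (fun (σ : ℤ → ℝ × ℝ) (z : ℤ) => σ (-z))
          = (a ∘ chainShift x) ∘ (D.flow s ∘ fun (σ : ℤ → ℝ × ℝ) (z : ℤ) => σ (-z)) := rfl
        _ = (a ∘ chainShift x) ∘ ((fun (σ : ℤ → ℝ × ℝ) (z : ℤ) => σ (-z)) ∘ D.flow s) := by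
            rw [hrefl s]
        _ = (a ∘ (chainShift x ∘ fun (σ : ℤ → ℝ × ℝ) (z : ℤ) => σ (-z))) ∘ D.flow s := rfl
        _ = ((a ∘ fun (σ : ℤ → ℝ × ℝ) (z : ℤ) => σ (-z)) ∘ chainShift (-x)) ∘ D.flow s := by
            rw [h2]; rfl
        _ = ((c • (a' ∘ chainShift y)) ∘ chainShift (-x)) ∘ D.flow s := by rw [hc]
        _ = c • ((a' ∘ chainShift (y + -x)) ∘ D.flow s) := by
            rw [ShiftAction.map_add]; rfl
    rw [e]
    exact V.smul_mem c (Submodule.subset_span (hgenS a' ha' _ _))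
  -- strong continuity from the two diagonal generator autocorrelations
  have hform : ∀ a ∈ G, (fun t : ℝ => Z.form a (a ∘ D.flow t)) =
      fun t : ℝ => ∑' x : ℤ, cov[a, (a ∘ chainShift x) ∘ D.flow t; μ] := by
    intro a ha
    funext t
    have haV : a ∈ V := Submodule.subset_span (hGS a ha)
    rw [Z.form_eq_tsum haV (hV_flow t haV)]
    refine tsum_congr fun x => ?_
    have e : (a ∘ D.flow t) ∘ chainShift x = (a ∘ chainShift x) ∘ D.flow t := by
      rw [Function.comp_assoc, hsh t x]
      rfl
    rw [e]
  have hsc : Z.toFluctuationDynamics.IsStronglyContinuous := by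
    refine Z.isStronglyContinuous_of_generators le_rfl ?_ ?_
    · rw [hform _ hjG]; exact hcont _ hjG
    · rw [hform _ hhG]; exact hcont _ hhG
  refine ⟨Z, rfl, ⟨hRμ, hV_R, fun t => Eventually.of_forall fun σ => congrFun (hrev t) σ⟩, hV_ι,
    fun t => Eventually.of_forall fun σ => congrFun (hrefl t) σ, hsc⟩

end Summit.AtomisticToContinuum.FouriersLaw.Theorems.MourreDissolution

end
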